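import Mathlib

/-!
# SoloBlindQuarticDMFamily — bookkeeping certificate for PROPOSITION PQ4 (the ℚ(i)-ball product-quotient model)

Context (solo-blind census, work/s47/sheets.md §9).  PROPOSITION PQ4 models every K3 surface on a
`ℚ(i)`-ball of the `U² ⊕ D₄(-1)` face (strata `W₋ᵢ`, `W₋ⱼ`) by the product-quotient
`Y' = res((C × E₁₇₂₈)/ℤ₄)` with `C : y⁴ = (x-a₁)⋯(x-a₅)(x-a₆)³`.  This file certifies the finite
bookkeeping behind it:

* `eigenDim` : the Chevalley–Weil count `d_j = (Σ_k (j·m_k mod 4))/4 - 1` of `χ^j`-eigendifferentials of a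
  cyclic quartic cover `y⁴ = ∏ (x-a_k)^{m_k}` (all `m_k` odd, so every branch point is total and `∞` is
  unbranched when `4 ∣ Σ m_k`);
* `dm_family` : for `m = (1,1,1,1,1,3)` the eigen-dimensions are `(d₁,d₂,d₃) = (1,2,3)`, genus `6`,
  and Riemann–Hurwitz `2·6 - 2 = 4·(-2) + 6·3`;
* `unique_one_three` : among all branch data `m ∈ {1,3}⁶` with `4 ∣ Σ m_k` (the 3-moduli quartic families
  with six total branch points), `(d₁,d₃) = (1,3)` or `(3,1)` holds exactly when the number of `3`'s is `1`
  or `5` (one family up to conjugation), and otherwise `(d₁,d₃) = (2,2)` (Weil type) — checked by `decide`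
  over all `64` tuples;
* `euler_fibres` : an isotrivial `j = 1728` fibration with six singular fibres of types `III` (`e = 3`) or
  `III*` (`e = 9`) on a K3 surface (`e = 24`) has exactly five `III` and one `III*`;
* `picard_count` : `rank (U ⊕ A₁⁵ ⊕ E₇) = 14`, so the transcendental rank is `22 - 14 = 8`, and the
  discriminant exponent `5·1 + 1 = 6` of `A₁⁵ ⊕ E₇` is even (as is `6 - 2·t` for a torsion section of
  order `2^t`), which is what makes `disc T(Y')` a rational square in PQ4(b);
* `pg_choice` : the two choices of sign for the `ℤ₄`-action on `E` give `p_g = d₁ = 1` (K3) resp.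
  `p_g = d₃ = 3`.

No `sorry`, no new axioms; the geometry (Chevalley–Weil, Kodaira's classification, Hasse–Minkowski,
Jacobson, Deligne–Mostow, Buskin) is on paper.
-/

namespace Summit.HodgeConjecture.HodgeConjecture.Theorems.QuarticDMFamily

/-- Branch data of a cyclic quartic cover of `ℙ¹`: the six exponents `m_k`. -/
abbrev Datum := Fin 6 → ℕ

/-- `4 · (d_j + 1) = Σ_k (j·m_k mod 4)` — four times the shifted Chevalley–Weil count. -/
def fourD (m : Datum) (j : ℕ) : ℕ := ∑ k, (j * m k) % 4

/-- The Chevalley–Weil eigen-dimension `d_j = (Σ_k (j·m_k mod 4))/4 - 1`. -/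
def eigenDim (m : Datum) (j : ℕ) : ℕ := fourD m j / 4 - 1

/-- The Deligne–Mostow datum `(1,1,1,1,1,3)`, i.e. weights `(¼,¼,¼,¼,¼,¾)`. -/
def dm : Datum := ![1, 1, 1, 1, 1, 3]

/-- For `m = (1⁵,3)`: `Σ m_k = 8` (so `∞` is unbranched), eigen-dimensions `(1,2,3)`, genus `6`,
and Riemann–Hurwitz for a degree-4 cover of `ℙ¹` totally branched at six points. -/
theorem dm_family :
    (∑ k, dm k) = 8 ∧ eigenDim dm 1 = 1 ∧ eigenDim dm 2 = 2 ∧ eigenDim dm 3 = 3 ∧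
    eigenDim dm 1 + eigenDim dm 2 + eigenDim dm 3 = 6 ∧ (2 * 6 - 2 : ℤ) = 4 * (-2) + 6 * 3 := by
  refine ⟨by decide, by decide, by decide, by decide, by decide, by norm_num⟩

/-- The number of exponents equal to `3` in a datum. -/
def numThree (m : Datum) : ℕ := (Finset.univ.filter fun k => m k = 3).card

/-- Encode a `{1,3}`-valued datum by a bit vector. -/
def ofBits (b : Fin 6 → Bool) : Datum := fun k => if b k then 3 else 1

/-- Uniqueness of the `(1,3)` family: over all `64` data `m ∈ {1,3}⁶` with `4 ∣ Σ m_k`, the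
`ℚ(i)`-signature `(d₁,d₃)` is `(1,3)`/`(3,1)` exactly when `#{m_k = 3} ∈ {1,5}`, and `(2,2)` otherwise
(`#{m_k = 3} = 3`); in every case `d₂ = 2` and the genus is `6`. -/
theorem unique_one_three : ∀ b : Fin 6 → Bool, 4 ∣ (∑ k, ofBits b k) →
    ((eigenDim (ofBits b) 1 = 1 ∧ eigenDim (ofBits b) 3 = 3 ↔ numThree (ofBits b) = 1) ∧
     (eigenDim (ofBits b) 1 = 3 ∧ eigenDim (ofBits b) 3 = 1 ↔ numThree (ofBits b) = 5) ∧
     (eigenDim (ofBits b) 1 = 2 ∧ eigenDim (ofBits b) 3 = 2 ↔ numThree (ofBits b) = 3) ∧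
     eigenDim (ofBits b) 2 = 2 ∧
     eigenDim (ofBits b) 1 + eigenDim (ofBits b) 2 + eigenDim (ofBits b) 3 = 6) := by
  decide

/-- Euler numbers of the Kodaira fibres with monodromy of order `4` (`j = 1728`): `III ↦ 3`, `III* ↦ 9`;
six such fibres on a K3 surface (`e = 24`) are five of type `III` and one of type `III*`. -/
theorem euler_fibres : ∀ a b : ℕ, a + b = 6 → 3 * a + 9 * b = 24 → a = 5 ∧ b = 1 := by
  intro a b h1 h2; omega

/-- Picard bookkeeping for `Y'`: `rank(U ⊕ A₁⁵ ⊕ E₇) = 2 + 5 + 7 = 14`, transcendental rank `22 - 14 = 8`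
(`= 2·(d₁ + d₃)`), and the `2`-exponent of `disc(A₁⁵ ⊕ E₇) = 2⁶` stays even under an index-`2^t`
overlattice (`t ≤ 3`). -/
theorem picard_count :
    2 + 5 * 1 + 7 = 14 ∧ 22 - 14 = 8 ∧ 2 * (1 + 3) = 8 ∧ 5 * 1 + 1 = 6 ∧
    ∀ t : ℕ, t ≤ 3 → Even (6 - 2 * t) := by
  refine ⟨rfl, rfl, rfl, rfl, ?_⟩
  intro t ht
  interval_cases t <;> decide

/-- The sign choice for the `ℤ₄`-action on `E₁₇₂₈`: pairing `H^{1,0}(E)` with the `χ`- resp.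
`χ³`-eigendifferentials gives `p_g(Y') = d₁ = 1` (a K3 surface: with `q = 0`, `χ(𝒪) = 2` and
`K ≡ (2·0 - 2 + χ(𝒪))·F = 0`) resp. `p_g = d₃ = 3`. -/
theorem pg_choice :
    eigenDim dm 1 = 1 ∧ eigenDim dm 3 = 3 ∧ (2 * 0 - 2 + 2 : ℤ) = 0 ∧ (1 : ℤ) - 0 + 1 = 2 := by
  refine ⟨by decide, by decide, by norm_num, by norm_num⟩

end Summit.HodgeConjecture.HodgeConjecture.Theorems.QuarticDMFamily
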